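import Summits.QuantumFields.BalabanUV.T4Continuum.Support.DirichletSubregionRenormTower
import Summits.QuantumFields.BalabanUV.T4Continuum.Support.DirichletStarVectorTower

/-!
# T⁴ programme, spine node NE2 (U1a), sub-row Δ1 «NE2⁰-Dirichlet» — THE STAR-BOND VECTOR TOWER WITH THE RENORMALISED PAIRING:
# every star coarse bond HAS a star child (`hchild` proved), so the [B9]-faithful `Δ_a(Ω₀)` carries a defect-FREE tower whose
# complement law needs only a Poincaré-form bound INSIDE the region; in the class `E_k ≤ E₀·L^{−2k}` it converges at the TORUS RATE `L⁻¹`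

Thirteenth generation of the NE2 prover lineage P1 of the cell `pub-balaban` (row NE2 owner), file 5 (owner item O13-e; generic half =
file 4 `Support/DirichletSubregionRenormTower`: `nch`, `JnR`, `AnR`, `JnRᴴJnR = 1`, exact pairing, complement law from W1 + PF,
`freeTowerLaws_renorm_of`).  On the star carriers `starP L M S k = starReg (lev L k) M S` of file 2 (`Support/DirichletStarVectorTower`):

 * §1 **`nch_star_pos`** (`hchild`): a star bond `(x,ν)` with `x ∈ Ω` has the corner child `(L·x, ν)` in the star region (its block is
   `x`'s); one with `x + e_ν ∈ Ω` has the last-`ν`-layer child `(L·x + (L−1)e_ν, ν)`, whose `+e_ν` step crosses into the block of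
   `x + e_ν` (`face_cpt_add_off_iff`, `par_add_unitVec`, `par_cpt_add_off`);
 * §1b the two SOCKETS of PF (`igrad` = interior differences between star bonds; `poincareForm_of_sockets`: class Poincaré × interior
   gradient-form bound ⟹ PF) — the exact shapes the crew can discharge;
 * §2 ENDs **`freeTowerLaws_star_renorm_of (ha′) (hc) (hS) (hE) (hPF) (hinj)`** — `FreeTowerLaws (k ↦ regionDeltaA (lev L k) M a a′ S)
   (AnR starP) (JnR starP) 0 L^d (√(E k·γ⋆⁻¹)) e₁ 0`, NO pairing defect, displayed: W1 (ONE slice constant), PF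
   `‖(1 − J̃J̃ᴴ)w‖² ≤ E k·Re⟨w, Δ_a(Ω₀)_{k+1} w⟩` (a Poincaré inequality on the sibling classes INSIDE the star region times an INTERIOR
   gradient-form bound — no zero-extension), W3̃ (the injected law for `J̃`); **`towerLimitRate_star_renorm_of`** at any geometric rate;
   **`towerLimitRate_star_renorm_of_sq`**: in the class `E k ≤ E₀·(L⁻¹)^{2k}` with an injected law at rate `L⁻¹`, convergence at the TORUS
   RATE `L⁻¹` with constant `Cpert 0 √(E₀·γ⋆⁻¹) C₁ 0 0 0`.

CENSUS CONSEQUENCE (with file 3's no-go): the rate `(√L)⁻¹` of file 2 is an artefact of King's unnormalised pairing at the deficient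
blocks read through the zero-extension; with the renormalised pairing the Δ1 vector layer's rate is `L⁻¹` MODULO PF, and PF splits into
a lattice-geometric class Poincaré (full blocks and `(d−1)`-dimensional face layers; not in the tree) and an INTERIOR W2 (measured
level-uniform on slabs and boxes, `≍ L^{2k/3}` on re-entrant unions — leaf-07-g5's memo §5b; not proved).

HONEST FRAMING (T4-DAG p. 1).  `U = 1`; ONE region, ONE averaging scale inside `regionDeltaA`; the renormalised averaging is a MODEL
near `∂Ω₀` (Bałaban's (3.16) collar is not averaged at all); finite torus; linear layer; operator norm; statements OURS ([folklore];
`[cite:]` tags locate SHAPES); W1, PF, W3̃ DISPLAYED; NE2 (U1a) NOT proved; spine 0/9 unchanged; NOT [B9] (3.23)–(3.27) as printed;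
NOT infinite volume, NOT a mass gap, NOT the Clay problem, NOT summit progress.  HONEST DEPENDENCY: continuum YM on T⁴ ⇐ BetaPertH ∧
nine spine estimates (0/9 proved); BetaPertH ⇐ (D1) ∧ (D4) ∧ CAP+tail; G-an2-4 gates asym, D1 and NE2/3/4.  No `sorry`.
-/

noncomputable section

open scoped BigOperators ComplexConjugate Matrix Matrix.Norms.L2Operator

namespace Summit.QuantumFields.BalabanUV.T4Continuum.DirichletStarRenormTower

open Literature.MathematicalPhysics.QuantumFieldTheory.Balaban1983to89.B5Prop11Plancherel (Tor fine unitVec)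
open Literature.MathematicalPhysics.QuantumFieldTheory.Balaban1983to89.B5Prop11Lower (nsq nsq_nonneg)
open Literature.MathematicalPhysics.QuantumFieldTheory.Balaban1983to89.B5G183RateUnitTower (lev)
open Literature.MathematicalPhysics.QuantumFieldTheory.Balaban1983to89.B5G183RateTorus (cpt)
open Literature.MathematicalPhysics.QuantumFieldTheory.Balaban1983to89.B5G183RateTorusW (off)
open Summit.QuantumFields.BalabanUV.T4Continuum
open Summit.QuantumFields.BalabanUV.T4Continuum.CovariantAveragingTower (TowerLimitRate)
open Summit.QuantumFields.BalabanUV.T4Continuum.BalabanAveragedTowerUnit (idx)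
open Summit.QuantumFields.BalabanUV.T4Continuum.BalabanAveragedTowerModes (par par_cpt_add_off)
open Summit.QuantumFields.BalabanUV.T4Continuum.BackgroundResolventTower
open Summit.QuantumFields.BalabanUV.T4Continuum.BlockPairingGeometry (parT par_add_unitVec face_cpt_add_off_iff)
open Summit.QuantumFields.BalabanUV.T4Continuum.SubtypeCompression
open Summit.QuantumFields.BalabanUV.T4Continuum.RegionGaugeSlice (SliceCoercive)
open Summit.QuantumFields.BalabanUV.T4Continuum.RegionScalarCompression (QOm GOm)
open Summit.QuantumFields.BalabanUV.T4Continuum.RegionGaugeFixedVector (starReg curlR gradR avgR regionDeltaA)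
open Summit.QuantumFields.BalabanUV.T4Continuum.DirichletSubregionTowerOf (pidx)
open Summit.QuantumFields.BalabanUV.T4Continuum.DirichletSubregionRenormTower
open Summit.QuantumFields.BalabanUV.T4Continuum.DirichletStarVectorTower (starP blockReg_par_iff regionDeltaA_isHermitian gamStar
  gamStar_pos coercive_regionDeltaA_of_slice)
open Summit.QuantumFields.BalabanUV.Beta.GAN24.DirichletBoxTrace (blockReg)

variable {d : ℕ} (L : ℕ) [NeZero L] (M : Fin d → ℕ) [hM : ∀ μ, NeZero (M μ)] (S : Tor M → Prop) [DecidablePred S]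

/-! ## §1 Every star coarse bond has a star child -/

/-- the digit vector `(0, …, L−1 at ν, …, 0)` of the last `ν`-layer corner child. [folklore] -/
def lastDigit (ν : Fin d) : Fin d → Fin L := fun μ => if μ = ν then ⟨L - 1, Nat.sub_lt (Nat.pos_of_ne_zero (NeZero.ne L)) one_pos⟩ else 0

omit [DecidablePred S] in
/-- **`hchild` FOR THE STAR CARRIERS**: every level-`k` star bond has a level-`(k+1)` star child. [folklore] -/
theorem exists_star_child (k : ℕ) (i : pidx L M (starP L M S) k) :
    ∃ y : pidx L M (starP L M S) (k + 1), parT (lev L k) L M y.1 = i.1 := by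
  obtain ⟨⟨x, ν⟩, hx⟩ := i
  rcases hx with h1 | h2
  · -- `x ∈ Ω`: the corner child
    have hc : blockReg (lev L (k + 1)) M S (cpt (lev L k) L M x + off (lev L k) L M (fun _ => 0)) := by
      rw [← blockReg_par_iff, par_cpt_add_off]; exact h1
    exact ⟨⟨(cpt (lev L k) L M x + off (lev L k) L M (fun _ => 0), ν), Or.inl hc⟩, by
      show (par (lev L k) L M (cpt (lev L k) L M x + off (lev L k) L M fun _ => 0), ν) = (x, ν)
      rw [par_cpt_add_off]⟩
  · -- `x + e_ν ∈ Ω`: the last-`ν`-layer child, whose `+e_ν` step enters the block of `x + e_ν`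
    set y := cpt (lev L k) L M x + off (lev L k) L M (lastDigit L ν) with hy
    have hface : L ∣ (y ν).val + 1 := by
      rw [hy, face_cpt_add_off_iff]
      simp only [lastDigit, if_true]
      rw [Nat.sub_add_cancel (NeZero.one_le : 1 ≤ L)]
    have hpar : par (lev L k) L M (y + unitVec (fine (L * lev L k) M) ν) = x + unitVec (fine (lev L k) M) ν := by
      rw [par_add_unitVec, if_pos hface, hy, par_cpt_add_off]
    have hc : blockReg (lev L (k + 1)) M S (y + unitVec (fine (L * lev L k) M) ν) := by
      rw [← blockReg_par_iff, hpar]; exact h2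
    exact ⟨⟨(y, ν), Or.inr hc⟩, by
      show (par (lev L k) L M y, ν) = (x, ν)
      rw [hy, par_cpt_add_off]⟩

/-- hence `0 < nch` on every star coarse bond. [folklore] -/
theorem nch_star_pos : ∀ (k : ℕ) (i : pidx L M (starP L M S) k), 0 < nch L M (starP L M S) k i.1 := by
  intro k i
  obtain ⟨y, hy⟩ := exists_star_child L M S k i
  exact Finset.card_pos.mpr ⟨y, by simp [hy]⟩

/-! ## §1b The two sockets of PF: a class Poincaré inequality INSIDE the region × an interior gradient-form bound -/

section Sockets

variable (n : ℕ) [NeZero n]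

/-- THE INTERIOR DIFFERENCE in direction `μ` on the star bonds: `n·(w(y + e_μ) − w(y))` when `y + e_μ` is again a star bond, `0`
otherwise — differences between carriers only, NO zero-extension across `∂Ω₀`. [folklore] -/
def igrad (μ : Fin d) (w : {b // starReg n M S b} → ℂ) : {b // starReg n M S b} → ℂ := fun y =>
  if h : starReg n M S (y.1.1 + unitVec (fine n M) μ, y.1.2) then (n : ℂ) * (w ⟨(y.1.1 + unitVec (fine n M) μ, y.1.2), h⟩ - w y)
  else 0

end Sockets

/-- **PF FROM ITS TWO SOCKETS** (bookkeeping): a CLASS POINCARÉ inequality on the star carriers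
`‖(1 − J̃J̃ᴴ)w‖² ≤ P_k·Σ_μ ‖igrad_μ w‖²` (lattice geometry of the sibling classes — full blocks and `(d−1)`-dimensional face layers —,
expected with `P_k = c_d·L²·n_{k+1}^{−2}`; NOT in the tree) and an INTERIOR gradient-form bound `Σ_μ ‖igrad_μ w‖² ≤ CgI_k·Re⟨w, D w⟩`
(the interior W2; NOT proved) give PF with `E_k = P_k·CgI_k`. [folklore] -/
theorem poincareForm_of_sockets (k : ℕ) (D : Matrix (pidx L M (starP L M S) (k + 1)) (pidx L M (starP L M S) (k + 1)) ℂ)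
    {P CgI : ℝ} (hP0 : 0 ≤ P)
    (hP : ∀ w : pidx L M (starP L M S) (k + 1) → ℂ,
      nsq ((1 - JnR L M (starP L M S) k * (JnR L M (starP L M S) k)ᴴ) *ᵥ w)
        ≤ P * ∑ μ, nsq (igrad M S (lev L (k + 1)) μ w))
    (hI : ∀ w : pidx L M (starP L M S) (k + 1) → ℂ, ∑ μ, nsq (igrad M S (lev L (k + 1)) μ w) ≤ CgI * (star w ⬝ᵥ (D *ᵥ w)).re)
    (w : pidx L M (starP L M S) (k + 1) → ℂ) :
    nsq ((1 - JnR L M (starP L M S) k * (JnR L M (starP L M S) k)ᴴ) *ᵥ w) ≤ P * CgI * (star w ⬝ᵥ (D *ᵥ w)).re :=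
  (hP w).trans (by rw [mul_assoc]; exact mul_le_mul_of_nonneg_left (hI w) hP0)

/-! ## §2 The ENDs -/

section End

variable (a a' : ℝ)

/-- **THE DEFECT-FREE FREE TOWER LAWS OF `Δ_a(Ω₀)` WITH THE RENORMALISED PAIRING, MODULO W1 + PF + W3̃**. [folklore] -/
theorem freeTowerLaws_star_renorm_of (ha' : 0 < a') {c : ℝ} (hc : 0 < c)
    (hS : ∀ k, SliceCoercive (curlR (lev L k) M S) (gradR (lev L k) M S) (GOm (lev L k) M a' S) (QOm (lev L k) M S)
      (avgR (lev L k) M S) (a * ((lev L k : ℕ) : ℝ) ^ d) c)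
    {E : ℕ → ℝ} (hE : ∀ k, 0 ≤ E k)
    (hPF : ∀ (k : ℕ) (w : pidx L M (starP L M S) (k + 1) → ℂ),
      nsq ((1 - JnR L M (starP L M S) k * (JnR L M (starP L M S) k)ᴴ) *ᵥ w)
        ≤ E k * (star w ⬝ᵥ (regionDeltaA (lev L (k + 1)) M a a' S *ᵥ w)).re)
    {e₁ : ℕ → ℝ}
    (hinj : ∀ k, ‖(regionDeltaA (lev L (k + 1)) M a a' S)⁻¹ * JnR L M (starP L M S) k
        - JnR L M (starP L M S) k * (regionDeltaA (lev L k) M a a' S)⁻¹‖ ≤ e₁ k) :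
    FreeTowerLaws (fun k => regionDeltaA (lev L k) M a a' S) (AnR L M (starP L M S)) (JnR L M (starP L M S)) (fun _ => 0)
      ((L : ℝ) ^ d) (fun k => Real.sqrt (E k * (gamStar d a' c)⁻¹)) e₁ (fun _ => 0) :=
  freeTowerLaws_renorm_of L M (starP L M S) (fun k => regionDeltaA (lev L k) M a a' S) (nch_star_pos L M S)
    (fun k => regionDeltaA_isHermitian (lev L k) M a a' S) (gamStar_pos (d := d) a' hc) hE
    (fun k => coercive_regionDeltaA_of_slice (lev L k) M a a' S ha' hc (hS k)) hPF hinj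

/-- **CONVERGENCE WITH THE RENORMALISED PAIRING, MODULO W1 + PF + W3̃, AT ANY GEOMETRIC RATE** majorising `√(E k·γ⋆⁻¹)` and the
injected law. [folklore] -/
theorem towerLimitRate_star_renorm_of (ha' : 0 < a') {c : ℝ} (hc : 0 < c)
    (hS : ∀ k, SliceCoercive (curlR (lev L k) M S) (gradR (lev L k) M S) (GOm (lev L k) M a' S) (QOm (lev L k) M S)
      (avgR (lev L k) M S) (a * ((lev L k : ℕ) : ℝ) ^ d) c)
    {E : ℕ → ℝ} (hE : ∀ k, 0 ≤ E k)
    (hPF : ∀ (k : ℕ) (w : pidx L M (starP L M S) (k + 1) → ℂ),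
      nsq ((1 - JnR L M (starP L M S) k * (JnR L M (starP L M S) k)ᴴ) *ᵥ w)
        ≤ E k * (star w ⬝ᵥ (regionDeltaA (lev L (k + 1)) M a a' S *ᵥ w)).re)
    {θ C₀ C₁ : ℝ} (hθ1 : θ < 1) (h₀ : ∀ k, Real.sqrt (E k * (gamStar d a' c)⁻¹) ≤ C₀ * θ ^ k)
    (hinj : ∀ k, ‖(regionDeltaA (lev L (k + 1)) M a a' S)⁻¹ * JnR L M (starP L M S) k
        - JnR L M (starP L M S) k * (regionDeltaA (lev L k) M a a' S)⁻¹‖ ≤ C₁ * θ ^ k) :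
    TowerLimitRate (AnR L M (starP L M S)) ((L : ℝ) ^ d) (fun k => (regionDeltaA (lev L k) M a a' S)⁻¹) (Cpert 0 C₀ C₁ 0 0 0) θ :=
  towerLimitRate_renorm_of L M (starP L M S) (fun k => regionDeltaA (lev L k) M a a' S) (nch_star_pos L M S)
    (fun k => regionDeltaA_isHermitian (lev L k) M a a' S) (gamStar_pos (d := d) a' hc) hE
    (fun k => coercive_regionDeltaA_of_slice (lev L k) M a a' S ha' hc (hS k)) hPF hθ1 h₀ hinj

/-- **THE TORUS RATE `L⁻¹` IN THE CLASS `E_k ≤ E₀·L^{−2k}`** (= class Poincaré `c_d·L²·n_{k+1}^{−2}` × a level-UNIFORM interior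
gradient-form bound), with an injected law at rate `L⁻¹`. [folklore] -/
theorem towerLimitRate_star_renorm_of_sq (ha' : 0 < a') {c : ℝ} (hc : 0 < c)
    (hS : ∀ k, SliceCoercive (curlR (lev L k) M S) (gradR (lev L k) M S) (GOm (lev L k) M a' S) (QOm (lev L k) M S)
      (avgR (lev L k) M S) (a * ((lev L k : ℕ) : ℝ) ^ d) c)
    {E : ℕ → ℝ} {E₀ : ℝ} (hE : ∀ k, 0 ≤ E k) (hE₀ : ∀ k, E k ≤ E₀ * (((L : ℝ)⁻¹) ^ k) ^ 2)
    (hPF : ∀ (k : ℕ) (w : pidx L M (starP L M S) (k + 1) → ℂ),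
      nsq ((1 - JnR L M (starP L M S) k * (JnR L M (starP L M S) k)ᴴ) *ᵥ w)
        ≤ E k * (star w ⬝ᵥ (regionDeltaA (lev L (k + 1)) M a a' S *ᵥ w)).re)
    (hL : 2 ≤ L) {C₁ : ℝ}
    (hinj : ∀ k, ‖(regionDeltaA (lev L (k + 1)) M a a' S)⁻¹ * JnR L M (starP L M S) k
        - JnR L M (starP L M S) k * (regionDeltaA (lev L k) M a a' S)⁻¹‖ ≤ C₁ * ((L : ℝ)⁻¹) ^ k) :
    TowerLimitRate (AnR L M (starP L M S)) ((L : ℝ) ^ d) (fun k => (regionDeltaA (lev L k) M a a' S)⁻¹)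
      (Cpert 0 (Real.sqrt (E₀ * (gamStar d a' c)⁻¹)) C₁ 0 0 0) ((L : ℝ)⁻¹) := by
  set γ := gamStar d a' c with hγdef
  have hγ : 0 < γ := gamStar_pos (d := d) a' hc
  have hL1 : (1 : ℝ) < L := by exact_mod_cast lt_of_lt_of_le (by norm_num) hL
  have hθ1 : (L : ℝ)⁻¹ < 1 := inv_lt_one_of_one_lt₀ hL1
  have hθ0 : 0 ≤ (L : ℝ)⁻¹ := inv_nonneg.mpr (Nat.cast_nonneg L)
  have h₀ : ∀ k, Real.sqrt (E k * γ⁻¹) ≤ Real.sqrt (E₀ * γ⁻¹) * ((L : ℝ)⁻¹) ^ k := by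
    intro k
    have h1 : E k * γ⁻¹ ≤ (E₀ * γ⁻¹) * (((L : ℝ)⁻¹) ^ k) ^ 2 := by
      have := mul_le_mul_of_nonneg_right (hE₀ k) (inv_nonneg.mpr hγ.le)
      linarith [this]
    calc Real.sqrt (E k * γ⁻¹) ≤ Real.sqrt ((E₀ * γ⁻¹) * (((L : ℝ)⁻¹) ^ k) ^ 2) := Real.sqrt_le_sqrt h1
      _ = Real.sqrt (E₀ * γ⁻¹) * ((L : ℝ)⁻¹) ^ k := by
          rw [Real.sqrt_mul' _ (sq_nonneg _), Real.sqrt_sq (pow_nonneg hθ0 k)]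
  exact towerLimitRate_star_renorm_of L M S a a' ha' hc hS hE hPF hθ1 h₀ hinj

end End

end Summit.QuantumFields.BalabanUV.T4Continuum.DirichletStarRenormTower

end
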